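import Literature.Computability.AlgebraicComplexity.SimplifiableSUSP
import Summits.MatrixMultiplication.OmegaCensus.StrongUSPOmegaBound
import Summits.MatrixMultiplication.OmegaCensus.StrongUSPMaskCert
import HarnessLib

/-!
# ω-census, family (b′) STPP / USP: Anderson–Le 2023 Theorem 2 as a theorem, and `ω ≤ 2.505` from their printed
simplifiable `(23,7)`-SUSP

HONEST FRAMING (pub-omega census; verbatim): lottery ticket; floor = certified bounds/negative ranges.
Census BOOKKEEPING for the Cohn–Umans STPP / USP track (`pub-omega-stpp-*`), not progress on `ω`: the tree proves
`ω < 2.373` by the laser method; the value certified here, `2.505`, is Anderson–Le's printed headline (arXiv:2307.06463,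
Table 1, `k = 7`; abstract: "improve the bounds on ω from 2.66 to 2.505"), above CKSU's strong-USP family value
`2.4785` (`CKSUTriangleOmegaBound.lean`).  What is new is the GRADE: the printed theorem and the printed finite object are
both checked by the kernel, end to end, with no named fact.

## Content

* `omega_le_of_isSimplifiable` — **Anderson–Le 2023, Theorem 2** AS PRINTED ("Let `ε > 0`, if there is a simplifiable
  `(s,k)`-SUSP `P`, then there is an algorithm for multiplying `n`-by-`n` matrices in time `O(n^{ω+ε})` where
  `ω ≤ min_{m ∈ ℕ≥3} 3·(k log m − log s)/(k log(m−1))`"), for the tree's `omega ℂ` and the fixed-point form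
  `IsSimplifiable` of AL Def. 5 (`Literature/…/SimplifiableSUSP.lean`; AL Def. 5 implies it,
  `IsSimplifiableSUSP.isSimplifiable`).  Proof as printed (§4.2): the powers `P^N` are simplifiable (AL Cor. 5,
  `IsSimplifiable.pow`), hence strong USPs of `s^N` rows and width `N k` (`IsSimplifiable.isStrongUSP`); CKSU
  Cor. 3.6 / 16 for them (`omega_le_of_isStrongUSP`, `StrongUSPOmegaBound.lean`, itself CKSU Prop. 34 + Thm. 33 +
  Thm. 5.5, all tree theorems) gives `ω · k log(m−1) ≤ 3 (k log m − log s) + 3/N` after `log (s^N)! ≥ s^N (N log s − 1)`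
  (`omega_mul_le_of_isSimplifiable_pow`); `N → ∞`.  Decimal form `m^{3bk} ≤ s^{3b} (m−1)^{ak} ⇒ ω ≤ a/b`
  (`omega_le_div_of_isSimplifiable`).
* `isSimplifiable_of_suspMaskCheck` — the tree's bitmask closed-set certificate checker `suspMaskCheck`
  (`StrongUSPMaskCert.lean`, stpp-3 seat; soundness there: `isStrongUSP_of_suspMaskCheck`) replays exactly an AL
  Def.-4/5 simplification sequence (block `(p, S)`: `S` closed in face `p` of the current 3D graph — AL Lemma 4 with
  `E→ ∩ E(G) = ∅` — deletes the face-`p` edges entering `S`; acceptance: only the diagonal survives), so an accepted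
  certificate proves `IsSimplifiable`: a supported subgraph of `H_P` is never touched by a block (a closed walk of a
  face cannot leave a closed set).
* `isSimplifiable_AndersonLe_23_7` — Anderson–Le's printed "Simplifiable (23,7)-SUSP" (Appendix A) IS simplifiable
  (43-block certificate, emitter `run/shared/lean/pub/pub-omega/pub-omega-stpp-1-g3/code/simpcert.py`, replayed by an
  independent Python port of the checker before submission; `decide +kernel`, default limits), and
  `omega_le_of_simplifiableSUSP_23_7 : omega ℂ ≤ 2.505` (`m = 6`; exact value of the row
  `3(7 log 6 − log 23)/(7 log 5) = 2.5049087890…`; integer certificate `6^4200 ≤ 23^600 · 5^3507`) — versus `2.7063` for the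
  same object through CKSU Cor. 16 with `log 23!` (`StrongUSPOmegaBoundCensus.lean`).  The other Appendix-A objects
  ((2,2) … (78,10): AL Table 1 "Us" line 2.67 2.65 2.59 2.57 2.52 2.505 2.52 2.53 2.53) are rows of a sibling file.

References: M. Anderson, V. Le, COCOON 2023, arXiv:2307.06463, Thm. 2, §4.2, Table 1, App. A [AndersonLe2023];
H. Cohn, R. Kleinberg, B. Szegedy, C. Umans, FOCS 2005, arXiv:math/0511460, Cor. 16, Prop. 34 [CohnKleinbergSzegedyUmans2005].
-/

noncomputable section

namespace Summit.MatrixMultiplication.OmegaCensus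

open Literature.Computability.AlgebraicComplexity Equiv Relation

/-! ## Anderson–Le Theorem 2 -/

/-- Stirling from below: `s log s ≤ log s! + s` (from `s^s / s! ≤ e^s`). [folklore] -/
private theorem mul_log_le_log_factorial_add' (s : ℕ) :
    (s : ℝ) * Real.log s ≤ Real.log (Nat.factorial s : ℕ) + s := by
  have hf : (0 : ℝ) < (Nat.factorial s : ℕ) := by exact_mod_cast Nat.factorial_pos s
  have h := Real.pow_div_factorial_le_exp (s : ℝ) (Nat.cast_nonneg s) s
  rw [div_le_iff₀ hf] at h
  rcases Nat.eq_zero_or_pos s with hs | hs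
  · subst hs; simp
  have hpos : (0 : ℝ) < (s : ℝ) ^ s := by positivity
  have hlog := Real.log_le_log hpos h
  rw [Real.log_pow, Real.log_mul (Real.exp_pos _).ne' hf.ne', Real.log_exp] at hlog
  linarith

/-- **The inequality behind AL Theorem 2, one power at a time**: a simplifiable puzzle of `s ≥ 1` rows and width
`k ≥ 1` gives, for every `m ≥ 3` and every `N ≥ 1`, `ω · k log(m−1) ≤ 3 (k log m − log s) + 3 / N` — CKSU Cor. 16
(`omega_le_of_isStrongUSP`) for the strong USP `P^N` (`s^N` rows, width `N k`; AL Cor. 5 + §3.3) and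
`log (s^N)! ≥ s^N (N log s − 1)`. [cite: AndersonLe2023, Theorem 2 (proof, §4.2)] -/
theorem omega_mul_le_of_isSimplifiable_pow {s k : ℕ} {row : Fin s → Fin k → Fin 3}
    (hU : IsSimplifiable row) (hs : 0 < s) (hk : 0 < k) {m : ℕ} (hm : 3 ≤ m) {N : ℕ} (hN : 0 < N) :
    omega ℂ * ((k : ℝ) * Real.log ((m : ℝ) - 1)) ≤
      3 * ((k : ℝ) * Real.log m - Real.log s) + 3 / N := by
  have hSN : 0 < s ^ N := pow_pos hs N
  -- the N-th power puzzle, re-indexed by `Fin (s^N)` rows and `Fin (N k)` columns, is simplifiable, hence a strong USP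
  have hP : IsSimplifiable (fun (a : Fin (s ^ N)) (j : Fin (N * k)) =>
      puzzlePow row N (finFunctionFinEquiv.symm a) (finProdFinEquiv.symm j)) :=
    (hU.pow N).reindex finFunctionFinEquiv.symm finProdFinEquiv.symm
  have h0 := omega_le_of_isStrongUSP hP.isStrongUSP hSN (Nat.mul_pos hN hk) hm
  set S : ℕ := s ^ N with hSdef
  have hS' : (0 : ℝ) < (S : ℝ) := by exact_mod_cast hSN
  have hN' : (0 : ℝ) < (N : ℝ) := by exact_mod_cast hN
  have hk' : (0 : ℝ) < (k : ℝ) := by exact_mod_cast hk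
  have hX1 : (1 : ℝ) < (m : ℝ) - 1 := by
    have : (3 : ℝ) ≤ (m : ℝ) := by exact_mod_cast hm
    linarith
  have hL : 0 < Real.log ((m : ℝ) - 1) := Real.log_pos hX1
  have hA : (((S * (N * k) : ℕ) : ℝ)) = (S : ℝ) * ((N : ℝ) * (k : ℝ)) := by push_cast; ring
  rw [hA] at h0
  have hApos : (0 : ℝ) < (S : ℝ) * ((N : ℝ) * (k : ℝ)) := by positivity
  rw [le_div_iff₀ (mul_pos hApos hL)] at h0
  -- log S = N log s, and Stirling from below
  have hlogS : Real.log (S : ℝ) = (N : ℝ) * Real.log s := by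
    rw [hSdef, Nat.cast_pow, Real.log_pow]
  have hfact := mul_log_le_log_factorial_add' S
  rw [hlogS] at hfact
  have h1 : omega ℂ * ((k : ℝ) * Real.log ((m : ℝ) - 1)) * ((S : ℝ) * N) ≤
      (3 * ((k : ℝ) * Real.log m - Real.log s)) * ((S : ℝ) * N) + 3 * S := by
    nlinarith [h0, hfact]
  have h2 : (omega ℂ * ((k : ℝ) * Real.log ((m : ℝ) - 1)) - 3 * ((k : ℝ) * Real.log m - Real.log s)) * N ≤ 3 := by
    have h3 : ((omega ℂ * ((k : ℝ) * Real.log ((m : ℝ) - 1)) - 3 * ((k : ℝ) * Real.log m - Real.log s)) * N) * S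
        ≤ 3 * S := by nlinarith [h1]
    exact le_of_mul_le_mul_right h3 hS'
  rw [← le_div_iff₀ hN'] at h2
  linarith

/-- **Anderson–Le 2023, Theorem 2** (AS PRINTED: "Let `ε > 0`, if there is a simplifiable `(s,k)`-SUSP `P`, then there is
an algorithm for multiplying `n`-by-`n` matrices in time `O(n^{ω+ε})` where `ω ≤ min_{m ∈ ℕ≥3} 3·(k log m − log s)/(k log(m−1))`."),
for the tree's `omega ℂ`: every simplifiable puzzle (`IsSimplifiable`; AL Def. 5 implies it) of `s ≥ 1` rows and width
`k ≥ 1` gives, for every `m ≥ 3`, `ω ≤ 3 (k log m − log s) / (k log (m − 1))`.  Proof: the previous lemma for all `N ≥ 1`,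
`N → ∞`. [cite: AndersonLe2023, Theorem 2] -/
theorem omega_le_of_isSimplifiable {s k : ℕ} {row : Fin s → Fin k → Fin 3}
    (hU : IsSimplifiable row) (hs : 0 < s) (hk : 0 < k) {m : ℕ} (hm : 3 ≤ m) :
    omega ℂ ≤ 3 * ((k : ℝ) * Real.log m - Real.log s) / ((k : ℝ) * Real.log ((m : ℝ) - 1)) := by
  have hk' : (0 : ℝ) < (k : ℝ) := by exact_mod_cast hk
  have hX1 : (1 : ℝ) < (m : ℝ) - 1 := by
    have : (3 : ℝ) ≤ (m : ℝ) := by exact_mod_cast hm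
    linarith
  have hL : 0 < Real.log ((m : ℝ) - 1) := Real.log_pos hX1
  have hD : 0 < (k : ℝ) * Real.log ((m : ℝ) - 1) := mul_pos hk' hL
  rw [le_div_iff₀ hD]
  apply le_of_forall_pos_lt_add
  intro ε hε
  obtain ⟨N, hN⟩ := exists_nat_gt (3 / ε)
  have hNpos : (0 : ℝ) < N := lt_of_le_of_lt (by positivity) hN
  have hN1 : 0 < N := by exact_mod_cast hNpos
  have h := omega_mul_le_of_isSimplifiable_pow hU hs hk hm hN1
  have hsmall : (3 : ℝ) / N < ε := by
    rw [div_lt_iff₀ hNpos]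
    rw [div_lt_iff₀ hε] at hN
    linarith
  linarith

/-- The printed Theorem 2 for the printed Definition 5 verbatim (`IsSimplifiableSUSP`: "`H_P` simplifies to the trivial 3D
perfect matching"). [cite: AndersonLe2023, Theorem 2 and Definition 5] -/
theorem omega_le_of_isSimplifiableSUSP {s k : ℕ} {row : Fin s → Fin k → Fin 3}
    (hU : IsSimplifiableSUSP row) (hs : 0 < s) (hk : 0 < k) {m : ℕ} (hm : 3 ≤ m) :
    omega ℂ ≤ 3 * ((k : ℝ) * Real.log m - Real.log s) / ((k : ℝ) * Real.log ((m : ℝ) - 1)) :=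
  omega_le_of_isSimplifiable hU.isSimplifiable hs hk hm

/-- **Decimal consequences are integer inequalities** (as for `omega_le_div_of_isLocalStrongUSP`): with a simplifiable puzzle of
`s ≥ 1` rows and width `k ≥ 1`, `m ≥ 3` and naturals `a`, `b ≥ 1`, if `m^{3bk} ≤ s^{3b} · (m−1)^{ak}` then `ω ≤ a / b`.
[cite: AndersonLe2023, Theorem 2] -/
theorem omega_le_div_of_isSimplifiable {s k : ℕ} {row : Fin s → Fin k → Fin 3}
    (hU : IsSimplifiable row) (hs : 0 < s) (hk : 0 < k) {m : ℕ} (hm : 3 ≤ m) {a b : ℕ} (hb : 0 < b)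
    (h : m ^ (3 * b * k) ≤ s ^ (3 * b) * (m - 1) ^ (a * k)) :
    omega ℂ ≤ (a : ℝ) / (b : ℝ) := by
  have hB := omega_le_of_isSimplifiable hU hs hk hm
  have hX1 : (1 : ℝ) < (m : ℝ) - 1 := by
    have : (3 : ℝ) ≤ (m : ℝ) := by exact_mod_cast hm
    linarith
  have hX0 : (0 : ℝ) < (m : ℝ) - 1 := by linarith
  have hs' : (0 : ℝ) < (s : ℝ) := by exact_mod_cast hs
  have hk' : (0 : ℝ) < (k : ℝ) := by exact_mod_cast hk
  have hb' : (0 : ℝ) < (b : ℝ) := by exact_mod_cast hb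
  have hm0 : (0 : ℝ) < (m : ℝ) := by linarith
  have hlogX : 0 < Real.log ((m : ℝ) - 1) := Real.log_pos hX1
  have hD : 0 < (k : ℝ) * Real.log ((m : ℝ) - 1) := mul_pos hk' hlogX
  have hR : ((m ^ (3 * b * k) : ℕ) : ℝ) ≤ ((s ^ (3 * b) * (m - 1) ^ (a * k) : ℕ) : ℝ) := by
    exact_mod_cast h
  rw [Nat.cast_pow, Nat.cast_mul, Nat.cast_pow, Nat.cast_pow, Nat.cast_sub (by omega : 1 ≤ m),
    Nat.cast_one] at hR
  have hpos1 : (0 : ℝ) < (m : ℝ) ^ (3 * b * k) := pow_pos hm0 _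
  have hlog := Real.log_le_log hpos1 hR
  rw [Real.log_pow, Real.log_mul (pow_pos hs' _).ne' (pow_pos hX0 _).ne', Real.log_pow, Real.log_pow] at hlog
  refine hB.trans ?_
  rw [div_le_div_iff₀ hD hb']
  push_cast at hlog ⊢
  nlinarith [hlog, hlogX, hk', hb', Real.log_pos (show (1 : ℝ) < 3 by norm_num)]

/-! ## From closed-set certificates to simplifiability -/

/-- A property closed under `r`-steps propagates along `ReflTransGen r`. [folklore] -/
private theorem reflTransGen_closed' {α : Type*} {r : α → α → Prop} {P : α → Prop}
    (hP : ∀ x y, r x y → P x → P y) {a b : α} (h : ReflTransGen r a b) (ha : P a) : P b := by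
  induction h with
  | refl => exact ha
  | tail _ hbc ih => exact hP _ _ hbc ih

/-- **An Anderson–Le simplification sequence replayed by the tree's checker proves simplifiability**: if the bitmask
closed-set certificate checker accepts (`suspMaskCheck row cert = true`: every block `(p, S)` has `S` closed in face `p` of the
current allowed-triple table and deletes the face-`p` edges entering `S`; at the end only diagonal triples are allowed), then
`row` is simplifiable in the fixed-point sense: every supported subgraph `T` of `H_P` stays allowed through the run (a closed
walk of a face of `T` cannot run from inside the closed set `S` to a vertex outside it), so `T` is diagonal.
[cite: AndersonLe2023, Lemma 4, Lemma 5 and Definition 5] -/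
theorem isSimplifiable_of_suspMaskCheck {s k : ℕ} {row : Fin s → Fin k → Fin 3} {cert : List (ℕ × ℕ)}
    (h : suspMaskCheck row cert = true) : IsSimplifiable row := by
  intro T hT hS
  -- invariant: every edge of `T` is allowed by the current table
  have hInv0 : ∀ a b c : Fin s, T a b c → mAllowedB (initTab row) a.val b.val c.val = true :=
    fun a b c habc => mAllowed_initTab row a b c (hT a b c habc)
  -- one block keeps the invariant
  have hstep : ∀ (TT : List (ℕ × List (ℕ × ℕ))) (p mS : ℕ), mblockValid s TT p mS = true →
      (∀ a b c : Fin s, T a b c → mAllowedB TT a.val b.val c.val = true) →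
      ∀ a b c : Fin s, T a b c → mAllowedB (mblockApply s TT p mS) a.val b.val c.val = true := by
    intro TT p mS hv hInv a b c habc
    apply mblockApply_keeps c.isLt (hInv a b c habc)
    rintro ⟨hx, hy⟩
    obtain ⟨h2, h1, h0⟩ := hS a b c habc
    -- closedness of S along the face used by the block
    have hcl : ∀ x y z : Fin s, T x y z → mS.testBit (mprojL p x.val y.val z.val) = true →
        mS.testBit (mprojR p x.val y.val z.val) = true :=
      fun x y z hxyz hL => mblockValid_sound hv z.isLt (hInv x y z hxyz) hL
    by_cases hp0 : p = 0
    · subst hp0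
      simp only [mprojL, mprojR, ↓reduceIte] at hx hy hcl
      have := reflTransGen_closed' (P := fun v : Fin s => mS.testBit v.val = true)
        (fun x y hxy hxS => by
          obtain ⟨z, hz⟩ := (uspFace_two_iff T x y).1 hxy
          exact hcl x y z hz hxS) h2 hy
      rw [hx] at this; exact Bool.noConfusion this
    · by_cases hp1 : p = 1
      · subst hp1
        simp only [mprojL, mprojR, one_ne_zero, ↓reduceIte] at hx hy hcl
        have := reflTransGen_closed' (P := fun v : Fin s => mS.testBit v.val = true)
          (fun x z hxz hxS => by
            obtain ⟨y, hy'⟩ := (uspFace_one_iff T x z).1 hxz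
            exact hcl x y z hy' hxS) h1 hy
        rw [hx] at this; exact Bool.noConfusion this
      · simp only [mprojL, mprojR, hp0, hp1, ↓reduceIte] at hx hy hcl
        have := reflTransGen_closed' (P := fun v : Fin s => mS.testBit v.val = true)
          (fun y z hyz hyS => by
            obtain ⟨x, hx'⟩ := (uspFace_zero_iff T y z).1 hyz
            exact hcl x y z hx' hyS) h0 hy
        rw [hx] at this; exact Bool.noConfusion this
  -- the whole run keeps the invariant
  have hrun : ∀ (cert : List (ℕ × ℕ)) (TT B : List (ℕ × List (ℕ × ℕ))),
      (∀ a b c : Fin s, T a b c → mAllowedB TT a.val b.val c.val = true) → maskRun s TT cert = some B →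
      ∀ a b c : Fin s, T a b c → mAllowedB B a.val b.val c.val = true := by
    intro cert
    induction cert with
    | nil =>
        intro TT B hInv hr
        simp only [maskRun, Option.some.injEq] at hr
        exact hr ▸ hInv
    | cons pm rest ih =>
        intro TT B hInv hr
        obtain ⟨p, mS⟩ := pm
        simp only [maskRun] at hr
        split_ifs at hr with hv
        exact ih _ B (hstep TT p mS hv hInv) hr
  unfold suspMaskCheck at h
  split at h
  · exact absurd h Bool.false_ne_true
  · rename_i B hB
    intro a b c habc
    have hfin := mfinalOK_sound h (hrun cert _ B hInv0 hB a b c habc)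
    exact ⟨Fin.ext hfin.1, Fin.ext hfin.2⟩

/-! ## The headline row: Anderson–Le's printed simplifiable (23,7)-SUSP -/

/-- **Anderson–Le's printed "Simplifiable (23,7)-SUSP"** (arXiv:2307.06463, Appendix A; 23 rows of width 7, in the printed row
order, symbols `1,2,3` coded `0,1,2` — the same literal as the tree's `isStrongUSP_AndersonLe_23_7`) **is simplifiable**:
a 43-block closed-set certificate (initial `|H_P| = 1775`) replayed by `suspMaskCheck` in the kernel (`decide +kernel`, default
limits). [cite: AndersonLe2023, Appendix A ("Simplifiable (23,7)-SUSP")] -/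
theorem isSimplifiable_AndersonLe_23_7 : IsSimplifiable ![![1,2,0,2,0,2,2], ![0,0,0,0,1,1,0], ![1,0,2,0,0,1,1], ![1,2,1,2,0,0,1], ![1,0,1,0,2,1,1], ![0,0,2,0,1,2,0], ![0,0,1,0,2,2,2], ![0,0,1,1,2,1,2], ![1,0,2,0,2,0,1], ![0,2,1,1,1,1,2], ![1,2,0,1,0,0,1], ![0,2,2,1,1,0,2], ![0,2,1,1,2,0,0], ![1,2,2,2,1,0,2], ![0,0,2,0,2,0,2], ![1,2,1,1,0,2,1], ![1,0,2,1,2,2,2], ![1,0,1,1,0,0,2], ![0,2,2,1,0,2,2], ![0,2,2,1,2,1,0], ![1,2,0,2,1,1,2], ![0,0,1,1,1,2,0], ![1,0,2,1,0,1,2]] :=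
  isSimplifiable_of_suspMaskCheck (cert := [(0, 2906850), (0, 16482), (1, 6504950), (2, 7331838), (0, 4424989), (1, 2097462), (1, 4325376), (2, 2136062), (2, 33792), (0, 4390912), (0, 16448), (1, 528384), (2, 2097982), (2, 4407296), (2, 131072), (0, 790656), (1, 2097154), (1, 36), (2, 24), (0, 1025), (1, 1082377), (2, 1048576), (2, 1), (0, 1024), (1, 1032), (1, 1024), (2, 16), (0, 256), (0, 4), (1, 4), (2, 514), (2, 2097152), (2, 2), (0, 2048), (1, 2048), (2, 524288), (0, 4096), (0, 128), (1, 16512), (1, 65536), (1, 128), (2, 4194304), (0, 131072)]) (by decide +kernel)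

/-- Census row (b′), KERNEL: **`ω ≤ 2.505` from Anderson–Le's printed simplifiable (23,7)-SUSP by their Theorem 2** with `m = 6`
(AL Table 1, `k = 7`, "Us": `ω ≤ 2.505`, AS PRINTED; exact value of the row `3(7 log 6 − log 23)/(7 log 5) = 2.5049087890…`,
so `2.505 = 501/200` is the 3-dp round-up; integer certificate `6^4200 ≤ 23^600 · 5^3507`).  The same object through CKSU Cor. 16
with `log 23!` gives only `2.7063` (`StrongUSPOmegaBoundCensus.lean`).  Not a competitive bound (tree: `ω < 2.373`; CKSU family
`2.4785`); it is the best printed FINITE-puzzle value of the Cohn–Umans programme, re-derived end-to-end in the kernel.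
[cite: AndersonLe2023, Theorem 2 and Table 1 (k = 7)] -/
theorem omega_le_of_simplifiableSUSP_23_7 : omega ℂ ≤ 2.505 := by
  have h := omega_le_div_of_isSimplifiable isSimplifiable_AndersonLe_23_7 (by norm_num) (by norm_num)
    (m := 6) (by norm_num) (a := 501) (b := 200) (by norm_num) (by decide +kernel)
  have e : ((501 : ℕ) : ℝ) / ((200 : ℕ) : ℝ) = 2.505 := by norm_num
  rwa [e] at h

end Summit.MatrixMultiplication.OmegaCensus

end
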